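/-
Copyright (c) 2026 the pub-hodgecm-mathlib formalisation cell (harness21).  Prover seat hodgecm-mathlib-K2E1-p14 (g0), Track B «K2-LIT» ENGINE E1, h413 =
`stmt-HodgeConjecture-24833`, route `HCCMUnconditional`, campaign «5Res» (b) «BL-2(χ,τ)» — X1_χ §2a (the CM constant-term DATA of the (χ,τ) ball system), dealer K2E1-plan (g7) (170);
REPORT-FIRST R5 on the K2 bus 11:58Z.
-/
import Summits.HodgeConjecture.HodgeConjecture.Theorems.K2E1ChiEisensteinSolvesXSystemU2            -- ★ row 11: S2_χ `cnstN_iota_toHX_eisensteinSeriesU_eq_chi_cm_two`, `intertwinedCoeff_mem_chiSectionSpace`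
import Summits.HodgeConjecture.HodgeConjecture.Theorems.K2E1ChiEisensteinConstantTermCMTwo           -- ★ row 2: `borelConstantTerm_chiEisenstein_cm_two`
import Summits.HodgeConjecture.HodgeConjecture.Theorems.K2E1ChiConstantTermColumnsIndependentU2      -- ★ hLinj: `hLinj_cm_two`, `zFun_sum_smul`, `coeFn_sum_smul_ae_eq`
import Summits.HodgeConjecture.HodgeConjecture.Theorems.K2E1ChiFlatSectionHNHolomorphicU2            -- ★ `differentiableOn_HN_of_ae_eq_zFun_flatSectionU[_one_sub]`, `norm_zFun_le`, `zFun_flatSectionU`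
import Summits.HodgeConjecture.HodgeConjecture.Theorems.K2E1ChiEisensteinMemHXCMTwo                  -- ★ row 4: `chiEisenstein_memHX_cm_two`
import Summits.HodgeConjecture.HodgeConjecture.Theorems.K2E1SphericalEisensteinMeromorphicExportsU2   -- ★ X1: brings `iotaBound_cm`, `measure_setOf_lt_ne_top_cm`, `isFiniteMeasure_weightedTruncMeasure_cm`, the unfolding disintegration
import HarnessLib

/-!
# h413 ∕ Track B «K2-LIT», 5Res (b) — `K2E1ChiEisensteinDataCMTwo` (X1_χ §2a): THE CONSTANT-TERM DATA OF THE (χ,τ) BERNSTEIN–LAPID SYSTEM OF `U(1,1)_{L∕L⁺}` AT THE CM PAIR —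
# `α₁(z) = [f_z^φ]`, the columns `[f^{φ′_j}_{1−z}]` and their injective coordinate family `L(z)`, the Eisenstein datum `eX(z) = [E(f_z^φ)]`, and the α-SYSTEM
# `cnst_N(ι eX(z)) = α₁(z) + L(z)(bX(z))` on the Godement part of every ball (row 12b's letters `hα₁d hL hLinj hsolC` DISCHARGED)

Cell `pub/hodgecm-mathlib`, crux H413 = `stmt-HodgeConjecture-24833`; dealer K2E1-plan (g7) (170) «X1_χ §2 = the CM package at the M1 datum».  THEOREMS ONLY (no `def`, no `instance`,
no `notation`, no named-fact hypothesis, no `sorry`); lane `--kind proof --supports stmt-HodgeConjecture-24833 --as helper` (count-neutral).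

THE MATHEMATICS [BernsteinLapid2019, §4 Claims 2 and 5, p. 10; MoeglinWaldspurger1995, II.1.7, IV.1.8].  For `φ ∈ V(χ, K′, ω)` (★ `chiSectionSpace`, `K′ ≤ K_U`) continuous and bounded, a
linearly independent family of continuous bounded `χʷ`-sections `φ′_j` (a basis of `V(χʷ, K′, ω)` in the consumer's hands) and a coordinate function `bX` with
`Σ_j bX(z)_j φ′_j = (ν𝓕)⁻¹·φ̃_z` on the Godement part of the ball (`φ̃_z` the intertwined coefficient, ★ row 3 ∕ `intertwinedCoeff_mem_chiSectionSpace`), this file produces on the ball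
`D_n = ball 0 (n+2)` (weight `k = n+3`, level `a`): `α₁(z) =ᵐ zFun(f_z^φ)` HOLOMORPHIC (★ p859772), the columns `col_j(z) =ᵐ zFun(f^{φ′_j}_{1−z})` HOLOMORPHIC (★ `_one_sub`), the coordinate
family `L(z) = Σ_j proj_j.smulRight col_j(z)` HOLOMORPHIC (`smulRightL` is a bounded bilinear device) and INJECTIVE on `D_n ∩ {1 < Re}` (★ `hLinj_cm_two`), the Eisenstein datum
`eX(z) = toHX E(f_z^φ)` (★ row 4) and the α-SYSTEM `cnst_N(ι(eX z)) = 1·α₁(z) + L(z)(bX z)` there (★ S2_χ `cnstN_iota_toHX_eisensteinSeriesU_eq_chi_cm_two` fed by ★ row 2's constant term, the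
★ unfolding disintegration and the square-integrabilities §1) — i.e. row 12b's letters `hα₁d`, `hL`, `hLinj`, `hsolC`, `hsolQ` (with `Q := 0`) at the CM pair, in ONE `∃`-package, for the
X1_χ CM assembly (§2b, `K2E1ChiEisensteinBallPackageCMTwo`).  §1 (generic rank): `zFun(f_w^φ) ∈ L²(wtm)` for bounded Borel `B(F)`-invariant `φ` and `|Re w| ≤ k` (weight ★ ℓ7).
HONEST LABEL: HC_CM is proved only modulo the 7 printed citations (2 remaining named inputs: hLiu418 = `stmt-HodgeConjecture-24832`, h413 = `stmt-HodgeConjecture-24833`) until rung 0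
closes; count-neutral helper, closes no socket.

## References
* [BernsteinLapid2019] J. Bernstein, E. Lapid, *On the meromorphic continuation of Eisenstein series*, J. Amer. Math. Soc. 37 (2024) (arXiv:1911.02342), §4 Claims 2, 5, p. 10.
* [MoeglinWaldspurger1995] C. Mœglin, J.-L. Waldspurger, *Spectral Decomposition and Eisenstein Series* (1995), I.2.13, II.1.7, IV.1.8.
-/

set_option autoImplicit false
-- the mandated namespace repeats `HodgeConjecture.HodgeConjecture`, as in every `Theorems/*.lean` of this sub-problem
set_option linter.dupNamespace false

noncomputable section

open MeasureTheory Filter Topology Set NumberField IsDedekindDomain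
open scoped NNReal ENNReal Classical ComplexConjugate
open Literature.MeasureTheory.Group Literature.NumberTheory Literature.NumberTheory.Automorphic Literature.NumberTheory.Automorphic.UnitaryGroup AdelicGroupData
open Literature.NumberTheory.GaloisRepresentations (HeckeCharacter)
open Summit.HodgeConjecture.HodgeConjecture.Cruxes.H413.K2E1BorelEisensteinU
open Summit.HodgeConjecture.HodgeConjecture.Cruxes.H413.K2E1BLBorelSpacesU2Defs
open Summit.HodgeConjecture.HodgeConjecture.Cruxes.H413.K2E1BLBorelOperatorsU2Defs
open Summit.HodgeConjecture.HodgeConjecture.Cruxes.H413.K2E1CharacterEisensteinU2Defs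
open Summit.HodgeConjecture.HodgeConjecture.Cruxes.H413.K2E1ChiSectionSpaceU2Defs
open Summit.HodgeConjecture.HodgeConjecture.Cruxes.H413.K2E1ChiIntertwinedSectionU2 (hasReflectedIntertwining_intertwinedCoeff_two)
open Summit.HodgeConjecture.HodgeConjecture.Cruxes.H413.K2E1ChiEisensteinSolvesXSystemU2 (cnstN_iota_toHX_eisensteinSeriesU_eq_chi_cm_two)
open Summit.HodgeConjecture.HodgeConjecture.Cruxes.H413.K2E1ChiEisensteinConstantTermCMTwo (borelConstantTerm_chiEisenstein_cm_two)
open Summit.HodgeConjecture.HodgeConjecture.Cruxes.H413.K2E1ChiConstantTermColumnsIndependentU2 (hLinj_cm_two zFun_sum_smul coeFn_sum_smul_ae_eq)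
open Summit.HodgeConjecture.HodgeConjecture.Cruxes.H413.K2E1ChiFlatSectionHNHolomorphicU2 (differentiableOn_HN_of_ae_eq_zFun_flatSectionU differentiableOn_HN_of_ae_eq_zFun_flatSectionU_one_sub norm_zFun_le zFun_flatSectionU)
open Summit.HodgeConjecture.HodgeConjecture.Cruxes.H413.K2E1ChiEisensteinMemHXCMTwo (chiEisenstein_memHX_cm_two)
open Summit.HodgeConjecture.HodgeConjecture.Cruxes.H413.K2E1BLHeightPowerHolomorphicU2 (memLp_borelQuotHeight_rpow_add_rpow norm_ofReal_cpow_le_rpow_add_rpow borelQuotHeight_pos)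
open Summit.HodgeConjecture.HodgeConjecture.Cruxes.H413.K2E1BLIotaUnfoldingU (measurable_borelQuotHeight)
open Summit.HodgeConjecture.HodgeConjecture.Cruxes.H413.K2E1BLInvariantSigmaDescentU (measurable_zFun_of_measurable)
open Summit.HodgeConjecture.HodgeConjecture.Cruxes.H413.K2E1BLIotaClosedEmbeddingU2 (iotaBound_cm isFiniteMeasure_weightedTruncMeasure_cm)
open Summit.HodgeConjecture.HodgeConjecture.Cruxes.H413.K2E1SphericalEisensteinMeromorphicSuppliersU2 (measure_setOf_lt_ne_top_cm)
open Summit.HodgeConjecture.HodgeConjecture.Cruxes.H413.K2E1BLFibreAverageInvarianceU (integral_zFun_borelConstantTerm_eq_of_unfolding)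
open Summit.HodgeConjecture.HodgeConjecture.Cruxes.H413.K2E1IntertwinedSectionInvariance (map_conj_toAdelic_eq_self_two)
open Summit.HodgeConjecture.HodgeConjecture.Cruxes.H413.K2E1SphericalEisensteinSolvesXSystemU2 (iota_toHX_eq_toHN)

namespace Summit.HodgeConjecture.HodgeConjecture.Cruxes.H413.K2E1ChiEisensteinDataCMTwo

/-! ## §1 Square-integrability of the `Z`-lift of a bounded flat section (generic rank) -/

section Generic

variable {F E : Type} [Field F] [NumberField F] [Field E] [NumberField E] [Algebra F E] {c : E ≃ₐ[F] E} {N : ℕ} [NeZero N]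
variable [MeasurableSpace (quasiSplit F E c N).Adelic] [BorelSpace (quasiSplit F E c N).Adelic]

/-- **`zFun (f_w^φ) ∈ L²(wtm_{k,c₁})` for a bounded Borel left-`B(F)`-invariant `φ` and `σ₀ ≤ Re w ≤ σ₁ ≤ k`**: `|zFun φ · HZ^w| ≤ M·(HZ^{σ₀} + HZ^{σ₁})` with the ★ ℓ7 weight
`memLp_borelQuotHeight_rpow_add_rpow` (the membership behind `toHN (f_w^φ)`, `α₁` and the columns of `L`). [cite: BernsteinLapid2019, §4 p. 10] [cite: MoeglinWaldspurger1995, I.2.13] -/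
theorem memLp_zFun_flatSectionU_of_norm_le {k : ℕ} {c₁ : ℝ≥0} (hc₁ : 0 < c₁) {μZ : Measure (borelQuotient F E c N)} (hfin : μZ {z | c₁ < borelQuotHeight F E c N z} ≠ ∞)
    {σ₀ σ₁ : ℝ} (hσ₀ : σ₀ ≤ k) (hσ₁ : σ₁ ≤ k) {φ : (quasiSplit F E c N).Adelic → ℂ} (hφm : Measurable φ) (hφB : ∀ γ ∈ ratBorelSubgroup F E c N, ∀ g, φ (γ * g) = φ g)
    {M : ℝ} (hφM : ∀ g, ‖φ g‖ ≤ M) {w : ℂ} (hw : σ₀ ≤ w.re ∧ w.re ≤ σ₁) :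
    MemLp (zFun F E c N (flatSectionU φ w)) 2 (weightedTruncMeasure F E c N k c₁ μZ) := by
  rw [zFun_flatSectionU]
  refine MemLp.of_le_mul (c := max M 0) (memLp_borelQuotHeight_rpow_add_rpow hc₁ hfin hσ₀ hσ₁) ?_ (Filter.Eventually.of_forall fun x => ?_)
  · exact ((measurable_zFun_of_measurable hφm hφB).mul ((Complex.measurable_ofReal.comp measurable_borelQuotHeight.coe_nnreal_real).pow_const w)).aestronglyMeasurable
  · rw [norm_mul, Real.norm_of_nonneg (add_nonneg (Real.rpow_nonneg (NNReal.coe_nonneg _) _) (Real.rpow_nonneg (NNReal.coe_nonneg _) _))]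
    exact mul_le_mul ((norm_zFun_le hφM x).trans (le_max_left _ _)) (norm_ofReal_cpow_le_rpow_add_rpow (borelQuotHeight_pos x) hw.1 hw.2) (norm_nonneg _) (le_max_right _ _)

end Generic

/-! ## §2 The CM pair: the constant-term data of the (χ,τ) ball system -/

section CM

variable (L : Type) [Field L] [NumberField L] [IsCMField L]
  [MeasurableSpace (quasiSplit (↥(maximalRealSubfield L)) L (IsCMField.complexConj L) 2).Adelic] [BorelSpace (quasiSplit (↥(maximalRealSubfield L)) L (IsCMField.complexConj L) 2).Adelic]

/-- **X1_χ §2a — THE CONSTANT-TERM DATA OF THE (χ,τ) BALL SYSTEM AT THE CM PAIR** (module docstring): on `D_n = ball 0 (n+2)` (weight `n+3`, ANY level `a > 0` below the ι-threshold is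
allowed; here the consumer's `a`, with `hb := iotaBound_cm …`), the package `∃ hb α₁ col eX` with — `α₁ z =ᵐ zFun (f_z^φ)` and `col j z =ᵐ zFun (f^{φ′_j}_{1−z})` on `D_n`, both HOLOMORPHIC
there, `L(z) := Σ_j proj_j.smulRight (col j z)` HOLOMORPHIC on `D_n` and INJECTIVE on `D_n ∩ {1 < Re}`, the Godement agreement `eX z =ᵐ [E(f_z^φ)]` and the α-SYSTEM
`cnst_N(ι(eX z)) = 1 • α₁ z + L(z)(bX z)` for `z ∈ D_n`, `1 < Re z`.  Letters: NONE beyond the structural binders and the coordinate identity `hbX`.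
[cite: BernsteinLapid2019, §4 Claims 2 and 5, p. 10] [cite: MoeglinWaldspurger1995, II.1.7, IV.1.8] -/
theorem exists_chi_constantTerm_data_cm_two
    (μ : Measure (quasiSplit (↥(maximalRealSubfield L)) L (IsCMField.complexConj L) 2).automorphicQuotient) [(quasiSplit (↥(maximalRealSubfield L)) L (IsCMField.complexConj L) 2).IsAutomorphicMeasure μ]
    (νG : Measure (quasiSplit (↥(maximalRealSubfield L)) L (IsCMField.complexConj L) 2).Adelic) [νG.IsHaarMeasure] [νG.IsInvInvariant] [SFinite νG]
    (ν : Measure ↥(adelicUnipotent (↥(maximalRealSubfield L)) L (IsCMField.complexConj L) 2)) [ν.IsHaarMeasure] [ν.IsMulRightInvariant] [ν.IsInvInvariant]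
    {𝓕 : Set ↥(adelicUnipotent (↥(maximalRealSubfield L)) L (IsCMField.complexConj L) 2)}
    (h𝓕N : IsFundamentalDomain ↥(rationalUnipotent (↥(maximalRealSubfield L)) L (IsCMField.complexConj L) 2) 𝓕 ν) (h𝓕c : IsCompact (closure 𝓕)) (h𝓕₀ : ν 𝓕 ≠ 0)
    {β : (quasiSplit (↥(maximalRealSubfield L)) L (IsCMField.complexConj L) 2).Adelic → ℝ≥0∞}
    (hβ : IsCoveringWeight ↥((arithmeticBorel (↥(maximalRealSubfield L)) L (IsCMField.complexConj L) 2).map (quasiSplit (↥(maximalRealSubfield L)) L (IsCMField.complexConj L) 2).arithmeticSubgroup.subtype) β)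
    {μZ : Measure (borelQuotient (↥(maximalRealSubfield L)) L (IsCMField.complexConj L) 2)} [SFinite μZ]
    (hμZ : ∀ f : borelQuotient (↥(maximalRealSubfield L)) L (IsCMField.complexConj L) 2 → ℝ≥0∞, Measurable f → ∫⁻ z, f z ∂μZ = ∫⁻ g, β g * f (toBorelQuotient (↥(maximalRealSubfield L)) L (IsCMField.complexConj L) 2 g) ∂νG)
    {δ : L} (hcδ : IsCMField.complexConj L δ = -δ) (hδ : δ ≠ 0)
    (n : ℕ) {a : ℝ≥0} (ha : 0 < a)
    -- the section data: `φ ∈ V(χ, K′, ω)` continuous bounded, a linearly independent family of continuous bounded `χʷ`-sections `φ′_j`, and the coordinates `bX` of `(ν𝓕)⁻¹·φ̃_z`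
    {χ : HeckeCharacter L} {K' : Subgroup (quasiSplit (↥(maximalRealSubfield L)) L (IsCMField.complexConj L) 2).Adelic} {ω : ↥K' → ℂ} {φ : (quasiSplit (↥(maximalRealSubfield L)) L (IsCMField.complexConj L) 2).Adelic → ℂ} (hφV : φ ∈ chiSectionSpace χ K' ω) (hφc : Continuous φ) {Mφ : ℝ} (hφM : ∀ x, ‖φ x‖ ≤ Mφ)
    {ι' : Type} [Fintype ι'] {φ' : ι' → (quasiSplit (↥(maximalRealSubfield L)) L (IsCMField.complexConj L) 2).Adelic → ℂ} (hli : LinearIndependent ℂ φ') (hφ'c : ∀ j, Continuous (φ' j))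
    (hφ'χ : ∀ j, IsChiSection (reflectChar (IsCMField.complexConj L) χ) (φ' j)) {Mb : ℝ} (hφ'M : ∀ j x, ‖φ' j x‖ ≤ Mb)
    (bX : ℂ → ι' → ℂ)
    (hbX : ∀ z ∈ Metric.ball (0 : ℂ) (n + 2), 1 < z.re → (∑ j, bX z j • φ' j) = ((((ν 𝓕).toReal⁻¹ : ℝ)) : ℂ) • (fun g : (quasiSplit (↥(maximalRealSubfield L)) L (IsCMField.complexConj L) 2).Adelic => (∫ v : ↥(adelicUnipotent (↥(maximalRealSubfield L)) L (IsCMField.complexConj L) 2), flatSectionU φ z ((quasiSplit (↥(maximalRealSubfield L)) L (IsCMField.complexConj L) 2).toAdelic (weylLongU ((IsCMField.complexConj L : L ≃ₐ[↥(maximalRealSubfield L)] L) : L →+* L) (rfl : (StdForm.antidiagonal 2).over L = (StdForm.antidiagonal 2).over L)) * ((v : (quasiSplit (↥(maximalRealSubfield L)) L (IsCMField.complexConj L) 2).Adelic) * g)) ∂ν) * (((borelHeight g : ℝ) : ℂ) ^ (z - 1)))) :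
    ∃ (hb : IotaBound (↥(maximalRealSubfield L)) L (IsCMField.complexConj L) 2 (n + 3) a μ μZ) (α₁ : ℂ → HN (↥(maximalRealSubfield L)) L (IsCMField.complexConj L) 2 (n + 3) a μZ) (col : ι' → ℂ → HN (↥(maximalRealSubfield L)) L (IsCMField.complexConj L) 2 (n + 3) a μZ) (eX : ℂ → HX (↥(maximalRealSubfield L)) L (IsCMField.complexConj L) 2 (n + 3) μ),
      (∀ z ∈ Metric.ball (0 : ℂ) (n + 2), (α₁ z : borelQuotient (↥(maximalRealSubfield L)) L (IsCMField.complexConj L) 2 → ℂ) =ᵐ[weightedTruncMeasure (↥(maximalRealSubfield L)) L (IsCMField.complexConj L) 2 (n + 3) a μZ] zFun (↥(maximalRealSubfield L)) L (IsCMField.complexConj L) 2 (flatSectionU φ z)) ∧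
      DifferentiableOn ℂ α₁ (Metric.ball (0 : ℂ) (n + 2)) ∧
      (∀ j, ∀ z ∈ Metric.ball (0 : ℂ) (n + 2), (col j z : borelQuotient (↥(maximalRealSubfield L)) L (IsCMField.complexConj L) 2 → ℂ) =ᵐ[weightedTruncMeasure (↥(maximalRealSubfield L)) L (IsCMField.complexConj L) 2 (n + 3) a μZ] zFun (↥(maximalRealSubfield L)) L (IsCMField.complexConj L) 2 (flatSectionU (φ' j) (1 - z))) ∧
      (∀ j, DifferentiableOn ℂ (col j) (Metric.ball (0 : ℂ) (n + 2))) ∧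
      DifferentiableOn ℂ (fun z => (∑ j, (ContinuousLinearMap.proj (R := ℂ) (φ := fun _ : ι' => ℂ) j).smulRight (col j z) : (ι' → ℂ) →L[ℂ] HN (↥(maximalRealSubfield L)) L (IsCMField.complexConj L) 2 (n + 3) a μZ)) (Metric.ball (0 : ℂ) (n + 2)) ∧
      (∀ z ∈ Metric.ball (0 : ℂ) (n + 2), 1 < z.re → Function.Injective ((∑ j, (ContinuousLinearMap.proj (R := ℂ) (φ := fun _ : ι' => ℂ) j).smulRight (col j z) : (ι' → ℂ) →L[ℂ] HN (↥(maximalRealSubfield L)) L (IsCMField.complexConj L) 2 (n + 3) a μZ) : (ι' → ℂ) → HN (↥(maximalRealSubfield L)) L (IsCMField.complexConj L) 2 (n + 3) a μZ)) ∧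
      (∀ z ∈ Metric.ball (0 : ℂ) (n + 2), 1 < z.re → ((eX z : HX (↥(maximalRealSubfield L)) L (IsCMField.complexConj L) 2 (n + 3) μ) : (quasiSplit (↥(maximalRealSubfield L)) L (IsCMField.complexConj L) 2).automorphicQuotient → ℂ) =ᵐ[(μ.withDensity fun x => (((supHeight (↥(maximalRealSubfield L)) L (IsCMField.complexConj L) 2 x)⁻¹ ^ (2 * (n + 3)) : ℝ≥0) : ℝ≥0∞))] (quasiSplit (↥(maximalRealSubfield L)) L (IsCMField.complexConj L) 2).quotFun (eisensteinSeriesU (flatSectionU φ z))) ∧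
      (∀ z ∈ Metric.ball (0 : ℂ) (n + 2), 1 < z.re → cnstN (↥(maximalRealSubfield L)) L (IsCMField.complexConj L) 2 (n + 3) a μZ (iota hb (eX z)) = (1 : ℂ) • α₁ z + (∑ j, (ContinuousLinearMap.proj (R := ℂ) (φ := fun _ : ι' => ℂ) j).smulRight (col j z) : (ι' → ℂ) →L[ℂ] HN (↥(maximalRealSubfield L)) L (IsCMField.complexConj L) 2 (n + 3) a μZ) (bX z)) := by
  have hc : IsCMField.complexConj L * IsCMField.complexConj L = 1 := AlgEquiv.ext fun x => by rw [AlgEquiv.mul_apply, AlgEquiv.one_apply, IsCMField.complexConj_apply_apply]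
  have hc1 : IsCMField.complexConj L ≠ 1 := IsCMField.complexConj_ne_one L
  have h𝓕top : ν 𝓕 ≠ ∞ := ((measure_mono subset_closure).trans_lt h𝓕c.measure_lt_top).ne
  haveI : νG.IsMulRightInvariant := by rw [← Measure.inv_eq_self νG]; infer_instance
  have hb : IotaBound (↥(maximalRealSubfield L)) L (IsCMField.complexConj L) 2 (n + 3) a μ μZ := iotaBound_cm L μ νG hβ hμZ ha (n + 3)
  have hfin : μZ {z | a < borelQuotHeight (↥(maximalRealSubfield L)) L (IsCMField.complexConj L) 2 z} ≠ ∞ := measure_setOf_lt_ne_top_cm L μ νG hβ hμZ ha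
  haveI : IsFiniteMeasure (weightedTruncMeasure (↥(maximalRealSubfield L)) L (IsCMField.complexConj L) 2 (n + 3) a μZ) := isFiniteMeasure_weightedTruncMeasure_cm L μ νG hβ hμZ ha (n + 3)
  have hD : IsOpen (Metric.ball (0 : ℂ) (n + 2)) := Metric.isOpen_ball
  have hre : ∀ z ∈ Metric.ball (0 : ℂ) (n + 2), |z.re| < n + 2 := fun z hz => lt_of_le_of_lt (Complex.abs_re_le_norm z) (by rwa [Metric.mem_ball, dist_zero_right] at hz)
  have hk : ((n : ℝ) + 2) ≤ ((n + 3 : ℕ) : ℝ) := by push_cast; linarith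
  -- the invariances of the sections (★ DEFS LEAF)
  have hφB : ∀ γ ∈ ratBorelSubgroup (↥(maximalRealSubfield L)) L (IsCMField.complexConj L) 2, ∀ g, φ (γ * g) = φ g := K2E1ChiConstantTermColumnsIndependentU2.ratBorel_mul_of_isChiSection hφV.1
  have hφ'B : ∀ j, ∀ γ ∈ ratBorelSubgroup (↥(maximalRealSubfield L)) L (IsCMField.complexConj L) 2, ∀ g, φ' j (γ * g) = φ' j g := fun j => K2E1ChiConstantTermColumnsIndependentU2.ratBorel_mul_of_isChiSection (hφ'χ j)
  -- square-integrability of the `Z`-lifts on the ball (§1)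
  have hm₁ : ∀ z ∈ Metric.ball (0 : ℂ) (n + 2), MemLp (zFun (↥(maximalRealSubfield L)) L (IsCMField.complexConj L) 2 (flatSectionU φ z)) 2 (weightedTruncMeasure (↥(maximalRealSubfield L)) L (IsCMField.complexConj L) 2 (n + 3) a μZ) := fun z hz =>
    memLp_zFun_flatSectionU_of_norm_le (σ₀ := -((n : ℝ) + 2)) (σ₁ := (n : ℝ) + 2) ha hfin (by push_cast; linarith) hk hφc.measurable hφB hφM
      ⟨by linarith [(abs_lt.1 (hre z hz)).1], by linarith [(abs_lt.1 (hre z hz)).2]⟩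
  have hm₂ : ∀ j, ∀ z ∈ Metric.ball (0 : ℂ) (n + 2), MemLp (zFun (↥(maximalRealSubfield L)) L (IsCMField.complexConj L) 2 (flatSectionU (φ' j) (1 - z))) 2 (weightedTruncMeasure (↥(maximalRealSubfield L)) L (IsCMField.complexConj L) 2 (n + 3) a μZ) := fun j z hz =>
    memLp_zFun_flatSectionU_of_norm_le (σ₀ := -((n : ℝ) + 1)) (σ₁ := (n : ℝ) + 3) ha hfin (by push_cast; linarith) (by push_cast; linarith) (hφ'c j).measurable (hφ'B j) (hφ'M j)
      ⟨by rw [Complex.sub_re, Complex.one_re]; linarith [(abs_lt.1 (hre z hz)).2], by rw [Complex.sub_re, Complex.one_re]; linarith [(abs_lt.1 (hre z hz)).1]⟩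
  -- `α₁`, the columns, and their holomorphy (★ p859772)
  obtain ⟨α₁, hα₁⟩ : ∃ α₁ : ℂ → HN (↥(maximalRealSubfield L)) L (IsCMField.complexConj L) 2 (n + 3) a μZ, α₁ = fun z => if hz : z ∈ Metric.ball (0 : ℂ) (n + 2) then toHN (↥(maximalRealSubfield L)) L (IsCMField.complexConj L) 2 (n + 3) a μZ (flatSectionU φ z) (hm₁ z hz) else 0 := ⟨_, rfl⟩
  obtain ⟨col, hcol⟩ : ∃ col : ι' → ℂ → HN (↥(maximalRealSubfield L)) L (IsCMField.complexConj L) 2 (n + 3) a μZ, col = fun j z => if hz : z ∈ Metric.ball (0 : ℂ) (n + 2) then toHN (↥(maximalRealSubfield L)) L (IsCMField.complexConj L) 2 (n + 3) a μZ (flatSectionU (φ' j) (1 - z)) (hm₂ j z hz) else 0 := ⟨_, rfl⟩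
  have hα₁z : ∀ z (hz : z ∈ Metric.ball (0 : ℂ) (n + 2)), α₁ z = toHN (↥(maximalRealSubfield L)) L (IsCMField.complexConj L) 2 (n + 3) a μZ (flatSectionU φ z) (hm₁ z hz) := fun z hz => by rw [hα₁]; exact dif_pos hz
  have hcolz : ∀ j z (hz : z ∈ Metric.ball (0 : ℂ) (n + 2)), col j z = toHN (↥(maximalRealSubfield L)) L (IsCMField.complexConj L) 2 (n + 3) a μZ (flatSectionU (φ' j) (1 - z)) (hm₂ j z hz) := fun j z hz => by rw [hcol]; exact dif_pos hz
  have hα₁ae : ∀ z ∈ Metric.ball (0 : ℂ) (n + 2), (α₁ z : borelQuotient (↥(maximalRealSubfield L)) L (IsCMField.complexConj L) 2 → ℂ) =ᵐ[weightedTruncMeasure (↥(maximalRealSubfield L)) L (IsCMField.complexConj L) 2 (n + 3) a μZ] zFun (↥(maximalRealSubfield L)) L (IsCMField.complexConj L) 2 (flatSectionU φ z) := fun z hz => by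
    rw [hα₁z z hz]; exact coeFn_toHN (↥(maximalRealSubfield L)) L (IsCMField.complexConj L) 2 (n + 3) a μZ _ _
  have hcolae : ∀ j, ∀ z ∈ Metric.ball (0 : ℂ) (n + 2), (col j z : borelQuotient (↥(maximalRealSubfield L)) L (IsCMField.complexConj L) 2 → ℂ) =ᵐ[weightedTruncMeasure (↥(maximalRealSubfield L)) L (IsCMField.complexConj L) 2 (n + 3) a μZ] zFun (↥(maximalRealSubfield L)) L (IsCMField.complexConj L) 2 (flatSectionU (φ' j) (1 - z)) := fun j z hz => by
    rw [hcolz j z hz]; exact coeFn_toHN (↥(maximalRealSubfield L)) L (IsCMField.complexConj L) 2 (n + 3) a μZ _ _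
  have hα₁d : DifferentiableOn ℂ α₁ (Metric.ball (0 : ℂ) (n + 2)) :=
    differentiableOn_HN_of_ae_eq_zFun_flatSectionU (σ₀ := -((n : ℝ) + 2)) (σ₁ := (n : ℝ) + 2) ha hfin (by push_cast; linarith) hk hφc.measurable hφB hφM hD
      (fun z hz => ⟨by linarith [(abs_lt.1 (hre z hz)).1], by linarith [(abs_lt.1 (hre z hz)).2]⟩) hα₁ae
  have hcold : ∀ j, DifferentiableOn ℂ (col j) (Metric.ball (0 : ℂ) (n + 2)) := fun j =>
    differentiableOn_HN_of_ae_eq_zFun_flatSectionU_one_sub (σ₀ := -((n : ℝ) + 1)) (σ₁ := (n : ℝ) + 3) ha hfin (by push_cast; linarith) (by push_cast; linarith) (hφ'c j).measurable (hφ'B j)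
      (hφ'M j) hD (fun z hz => ⟨by linarith [(abs_lt.1 (hre z hz)).2], by linarith [(abs_lt.1 (hre z hz)).1]⟩) (hcolae j)
  -- the coordinate family `L z = Σ_j proj_j.smulRight (col j z)`: holomorphic (bounded bilinear device `smulRightL`) and injective on the Godement part (★ hLinj)
  have hLd : DifferentiableOn ℂ (fun z => (∑ j, (ContinuousLinearMap.proj (R := ℂ) (φ := fun _ : ι' => ℂ) j).smulRight (col j z) : (ι' → ℂ) →L[ℂ] HN (↥(maximalRealSubfield L)) L (IsCMField.complexConj L) 2 (n + 3) a μZ)) (Metric.ball (0 : ℂ) (n + 2)) := by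
    refine DifferentiableOn.fun_sum fun j _ => ?_
    have hj : (fun z => ((ContinuousLinearMap.proj (R := ℂ) (φ := fun _ : ι' => ℂ) j).smulRight (col j z) : (ι' → ℂ) →L[ℂ] HN (↥(maximalRealSubfield L)) L (IsCMField.complexConj L) 2 (n + 3) a μZ)) =
        fun z => ContinuousLinearMap.smulRightL ℂ (ι' → ℂ) (HN (↥(maximalRealSubfield L)) L (IsCMField.complexConj L) 2 (n + 3) a μZ) (ContinuousLinearMap.proj (R := ℂ) (φ := fun _ : ι' => ℂ) j) (col j z) := rfl
    rw [hj]
    exact (ContinuousLinearMap.smulRightL ℂ (ι' → ℂ) (HN (↥(maximalRealSubfield L)) L (IsCMField.complexConj L) 2 (n + 3) a μZ) (ContinuousLinearMap.proj (R := ℂ) (φ := fun _ : ι' => ℂ) j)).differentiable.comp_differentiableOn (hcold j)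
  have hLinj := hLinj_cm_two L νG hβ hμZ hli hφ'c hφ'χ (1 : ℝ) n (n + 3) (w := fun z : ℂ => 1 - z) (α := col) (fun j z hz _ => hcolae j z hz)
  -- the Eisenstein datum `eX z = toHX E(f_z^φ)` on the Godement part of the ball (★ row 4), zero elsewhere
  have hzk : ∀ z ∈ Metric.ball (0 : ℂ) (n + 2), z.re ≤ ((n + 3 : ℕ) : ℝ) := fun z hz => by
    have h1 : z.re ≤ ‖z‖ := Complex.re_le_norm z
    have h2 : ‖z‖ < n + 2 := mem_ball_zero_iff.1 hz
    push_cast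
    linarith
  have hE : ∀ z : ℂ, z ∈ Metric.ball (0 : ℂ) (n + 2) ∧ 1 < z.re → MemLp ((quasiSplit (↥(maximalRealSubfield L)) L (IsCMField.complexConj L) 2).quotFun (eisensteinSeriesU (flatSectionU φ z))) 2 (μ.withDensity fun x => (((supHeight (↥(maximalRealSubfield L)) L (IsCMField.complexConj L) 2 x)⁻¹ ^ (2 * (n + 3)) : ℝ≥0) : ℝ≥0∞)) := fun z hz =>
    chiEisenstein_memHX_cm_two L hcδ hδ ν h𝓕N h𝓕c μ χ hφV.1 hφc hφM (n + 3) hz.2 (hzk z hz.1)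
  obtain ⟨eX, heX⟩ : ∃ eX : ℂ → HX (↥(maximalRealSubfield L)) L (IsCMField.complexConj L) 2 (n + 3) μ, eX = fun z => if hz : z ∈ Metric.ball (0 : ℂ) (n + 2) ∧ 1 < z.re then toHX (↥(maximalRealSubfield L)) L (IsCMField.complexConj L) 2 (n + 3) μ (eisensteinSeriesU (flatSectionU φ z)) (hE z hz) else 0 := ⟨_, rfl⟩
  have heXz : ∀ z (hz : z ∈ Metric.ball (0 : ℂ) (n + 2) ∧ 1 < z.re), eX z = toHX (↥(maximalRealSubfield L)) L (IsCMField.complexConj L) 2 (n + 3) μ (eisensteinSeriesU (flatSectionU φ z)) (hE z hz) := fun z hz => by rw [heX]; exact dif_pos hz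
  -- the disintegration letter of S2 (★ unfolding, `hconj` at `N = 2`)
  have hdis' : ∀ Φ : (quasiSplit (↥(maximalRealSubfield L)) L (IsCMField.complexConj L) 2).Adelic → ℂ, Measurable Φ → (∀ b ∈ ratBorelSubgroup (↥(maximalRealSubfield L)) L (IsCMField.complexConj L) 2, ∀ g, Φ (b * g) = Φ g) →
      Integrable (zFun (↥(maximalRealSubfield L)) L (IsCMField.complexConj L) 2 Φ) (weightedTruncMeasure (↥(maximalRealSubfield L)) L (IsCMField.complexConj L) 2 (n + 3) a μZ) → Integrable (zFun (↥(maximalRealSubfield L)) L (IsCMField.complexConj L) 2 (borelConstantTerm ν 𝓕 Φ)) (weightedTruncMeasure (↥(maximalRealSubfield L)) L (IsCMField.complexConj L) 2 (n + 3) a μZ) →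
        ∫ x, zFun (↥(maximalRealSubfield L)) L (IsCMField.complexConj L) 2 (borelConstantTerm ν 𝓕 Φ) x ∂(weightedTruncMeasure (↥(maximalRealSubfield L)) L (IsCMField.complexConj L) 2 (n + 3) a μZ) = ∫ x, zFun (↥(maximalRealSubfield L)) L (IsCMField.complexConj L) 2 Φ x ∂(weightedTruncMeasure (↥(maximalRealSubfield L)) L (IsCMField.complexConj L) 2 (n + 3) a μZ) := fun Φ hΦm hΦB hint hint' =>
    integral_zFun_borelConstantTerm_eq_of_unfolding νG ν (fun _ hb₀ => map_conj_toAdelic_eq_self_two hc hc1 ν hb₀) h𝓕N h𝓕₀ h𝓕top hβ hμZ (n + 3) a hΦm hΦB hint hint'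
  -- square-integrability of the intertwined coefficient's column, through the coordinate identity `hbX`
  have hflat : ∀ (b : ι' → ℂ) (w : ℂ), flatSectionU (∑ j, b j • φ' j) w = ∑ j, b j • flatSectionU (φ' j) w := fun b w => by
    funext g
    simp only [flatSectionU_apply, Finset.sum_apply, Pi.smul_apply, smul_eq_mul, Finset.sum_mul, mul_assoc]
  have hcne : ((((ν 𝓕).toReal⁻¹ : ℝ)) : ℂ) ≠ 0 := Complex.ofReal_ne_zero.2 (inv_ne_zero (ENNReal.toReal_pos h𝓕₀ h𝓕top).ne')
  have hsum2 : ∀ z ∈ Metric.ball (0 : ℂ) (n + 2), MemLp (zFun (↥(maximalRealSubfield L)) L (IsCMField.complexConj L) 2 (flatSectionU (∑ j, bX z j • φ' j) (1 - z))) 2 (weightedTruncMeasure (↥(maximalRealSubfield L)) L (IsCMField.complexConj L) 2 (n + 3) a μZ) := fun z hz => by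
    rw [hflat, zFun_sum_smul]
    exact memLp_finsetSum _ fun j _ => (hm₂ j z hz).const_mul _
  have hm₃ : ∀ z (hz : z ∈ Metric.ball (0 : ℂ) (n + 2) ∧ 1 < z.re), MemLp (zFun (↥(maximalRealSubfield L)) L (IsCMField.complexConj L) 2 (flatSectionU (fun g : (quasiSplit (↥(maximalRealSubfield L)) L (IsCMField.complexConj L) 2).Adelic => (∫ v : ↥(adelicUnipotent (↥(maximalRealSubfield L)) L (IsCMField.complexConj L) 2), flatSectionU φ z ((quasiSplit (↥(maximalRealSubfield L)) L (IsCMField.complexConj L) 2).toAdelic (weylLongU ((IsCMField.complexConj L : L ≃ₐ[↥(maximalRealSubfield L)] L) : L →+* L) (rfl : (StdForm.antidiagonal 2).over L = (StdForm.antidiagonal 2).over L)) * ((v : (quasiSplit (↥(maximalRealSubfield L)) L (IsCMField.complexConj L) 2).Adelic) * g)) ∂ν) * (((borelHeight g : ℝ) : ℂ) ^ (z - 1))) (1 - z))) 2 (weightedTruncMeasure (↥(maximalRealSubfield L)) L (IsCMField.complexConj L) 2 (n + 3) a μZ) := fun z hz => by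
    have hfun : zFun (↥(maximalRealSubfield L)) L (IsCMField.complexConj L) 2 (flatSectionU (fun g : (quasiSplit (↥(maximalRealSubfield L)) L (IsCMField.complexConj L) 2).Adelic => (∫ v : ↥(adelicUnipotent (↥(maximalRealSubfield L)) L (IsCMField.complexConj L) 2), flatSectionU φ z ((quasiSplit (↥(maximalRealSubfield L)) L (IsCMField.complexConj L) 2).toAdelic (weylLongU ((IsCMField.complexConj L : L ≃ₐ[↥(maximalRealSubfield L)] L) : L →+* L) (rfl : (StdForm.antidiagonal 2).over L = (StdForm.antidiagonal 2).over L)) * ((v : (quasiSplit (↥(maximalRealSubfield L)) L (IsCMField.complexConj L) 2).Adelic) * g)) ∂ν) * (((borelHeight g : ℝ) : ℂ) ^ (z - 1))) (1 - z)) = fun x => (((((ν 𝓕).toReal⁻¹ : ℝ)) : ℂ))⁻¹ * zFun (↥(maximalRealSubfield L)) L (IsCMField.complexConj L) 2 (flatSectionU (∑ j, bX z j • φ' j) (1 - z)) x := by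
      funext x
      rw [hbX z hz.1 hz.2]
      simp only [zFun_flatSectionU, zFun_smul, Pi.smul_apply, smul_eq_mul]
      rw [mul_assoc (((((ν 𝓕).toReal⁻¹ : ℝ)) : ℂ)), ← mul_assoc (((((ν 𝓕).toReal⁻¹ : ℝ)) : ℂ))⁻¹, inv_mul_cancel₀ hcne, one_mul]
    rw [hfun]
    exact (hsum2 z hz.1).const_mul _
  -- the α-system on the Godement part: ★ S2_χ with ★ row 2's constant term
  have hsolC : ∀ z ∈ Metric.ball (0 : ℂ) (n + 2), ∀ hz1 : 1 < z.re,
      cnstN (↥(maximalRealSubfield L)) L (IsCMField.complexConj L) 2 (n + 3) a μZ (iota hb (eX z)) = (1 : ℂ) • α₁ z + (∑ j, (ContinuousLinearMap.proj (R := ℂ) (φ := fun _ : ι' => ℂ) j).smulRight (col j z) : (ι' → ℂ) →L[ℂ] HN (↥(maximalRealSubfield L)) L (IsCMField.complexConj L) 2 (n + 3) a μZ) (bX z) := by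
    intro z hz hz1
    have hct : ∀ g : (quasiSplit (↥(maximalRealSubfield L)) L (IsCMField.complexConj L) 2).Adelic, borelConstantTerm ν 𝓕 (eisensteinSeriesU (flatSectionU φ z)) g = flatSectionU φ z g + ((((ν 𝓕).toReal⁻¹ : ℝ)) : ℂ) *
        ∫ v : ↥(adelicUnipotent (↥(maximalRealSubfield L)) L (IsCMField.complexConj L) 2), flatSectionU φ z ((quasiSplit (↥(maximalRealSubfield L)) L (IsCMField.complexConj L) 2).toAdelic (weylLongU ((IsCMField.complexConj L : L ≃ₐ[↥(maximalRealSubfield L)] L) : L →+* L) (rfl : (StdForm.antidiagonal 2).over L = (StdForm.antidiagonal 2).over L)) * ((v : (quasiSplit (↥(maximalRealSubfield L)) L (IsCMField.complexConj L) 2).Adelic) * g)) ∂ν := fun g => by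
      rw [borelConstantTerm_chiEisenstein_cm_two L ν h𝓕N h𝓕c hφV.1 hφc hφM hz1 g, Complex.real_smul]
      simp only [mul_assoc]
    have hS2 := cnstN_iota_toHX_eisensteinSeriesU_eq_chi_cm_two L ν h𝓕N hb hdis' hφV.1 hφc hφM hz1 hct (hE z ⟨hz, hz1⟩) (hm₁ z hz) (hm₃ z ⟨hz, hz1⟩)
    rw [heXz z ⟨hz, hz1⟩, hS2, one_smul, hα₁z z hz]
    congr 1
    -- `c • toHN (flatSectionU φ̃ (1−z)) = Σ_j bX z j • col j z` in `𝓗_k(Z_a)`, read a.e.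
    have hLapp : (∑ j, (ContinuousLinearMap.proj (R := ℂ) (φ := fun _ : ι' => ℂ) j).smulRight (col j z) : (ι' → ℂ) →L[ℂ] HN (↥(maximalRealSubfield L)) L (IsCMField.complexConj L) 2 (n + 3) a μZ) (bX z) = ∑ j, bX z j • col j z := by
      simp only [FunLike.coe_sum, Finset.sum_apply, ContinuousLinearMap.smulRight_apply, ContinuousLinearMap.proj_apply]
    rw [hLapp]
    refine Lp.ext ?_
    refine (Lp.coeFn_smul _ _).trans ?_
    refine EventuallyEq.trans ?_ (coeFn_sum_smul_ae_eq Finset.univ (bX z) (fun j => col j z)).symm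
    have hcols : ∀ᵐ x ∂(weightedTruncMeasure (↥(maximalRealSubfield L)) L (IsCMField.complexConj L) 2 (n + 3) a μZ), ∀ j, (col j z : borelQuotient (↥(maximalRealSubfield L)) L (IsCMField.complexConj L) 2 → ℂ) x = zFun (↥(maximalRealSubfield L)) L (IsCMField.complexConj L) 2 (flatSectionU (φ' j) (1 - z)) x :=
      ae_all_iff.2 fun j => hcolae j z hz
    filter_upwards [coeFn_toHN (↥(maximalRealSubfield L)) L (IsCMField.complexConj L) 2 (n + 3) a μZ _ (hm₃ z ⟨hz, hz1⟩), hcols] with x hx hxs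
    rw [Pi.smul_apply, hx, smul_eq_mul]
    simp only [hxs]
    have hsum := congrFun (zFun_sum_smul Finset.univ (bX z) (fun j => flatSectionU (φ' j) (1 - z))) x
    rw [← hflat] at hsum
    rw [← hsum, hbX z hz hz1]
    simp only [zFun_flatSectionU, zFun_smul, Pi.smul_apply, smul_eq_mul, mul_assoc]
  refine ⟨hb, α₁, col, eX, hα₁ae, hα₁d, hcolae, hcold, hLd, hLinj, fun z hz hz1 => ?_, fun z hz hz1 => hsolC z hz hz1⟩
  rw [heXz z ⟨hz, hz1⟩]
  exact MemLp.coeFn_toLp _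

end CM

end Summit.HodgeConjecture.HodgeConjecture.Cruxes.H413.K2E1ChiEisensteinDataCMTwo

end
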